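import Literature.Probability.LatticeModels.CorrelationDecay
import Literature.Probability.Percolation.Percolation
import Literature.Probability.LatticeModels.TriangularLattice
import Literature.Probability.Percolation.ArmEvents
import HarnessLib

-- provenance: harness21/H21/H21/Statements/CritPerc/ArmExponents.lean @ 32fb086 (interim HEAD d8f2665); M5 mechanical rewrite
/-!
# Arm exponents and near-critical exponents for site percolation on the triangular lattice

Family: crit-perc (trunk StatMech), statements **crit-perc.S15** and **crit-perc.S16**.

All statements concern Bernoulli site percolation on the triangular lattice `𝕋` (`triGraph`,
measure `triSitePercolation p`), whose critical point is `p_c = 1/2` (the shared constant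
`half : unitInterval` of `Percolation.lean`).

* **crit-perc.S15** (arm exponents at `p = 1/2`): the one-arm probability satisfies
  `P_{1/2}(0 ↔ ∂Λ_n) = n^{-5/48 + o(1)}` (Lawler–Schramm–Werner, *One-arm exponent for critical
  2D percolation*, Electron. J. Probab. 7 (2002), no. 2, Thm. 1.1), and the polychromatic
  `j`-arm probabilities in the annulus `Λ_R \ Λ_{r₀}` satisfy
  `P_{1/2}(armEvent κ r₀ R) = R^{-(j² - 1)/12 + o(1)}` as `R → ∞` for every fixed large enough
  `r₀`; in particular the two-arm exponent is `1/4` and the (alternating) four-arm exponent is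
  `5/4` (Smirnov–Werner, *Critical exponents for two-dimensional percolation*, Math. Res.
  Lett. 8 (2001), 729–744 = arXiv:math/0109120, Thm. 4 "Plane exponents"; restated as
  Bollobás–Riordan, *Percolation* (2006), Ch. 7, (54)).
* **crit-perc.S16** (near-critical exponents): `θ(p) = (p - 1/2)^{5/36 + o(1)}` as `p ↓ 1/2`,
  `ξ(p) = |p - 1/2|^{-4/3 + o(1)}` and `χ^f(p) = |p - 1/2|^{-43/18 + o(1)}` as `p → 1/2` from
  either side (Smirnov–Werner 2001, Thm. 1 "Behaviour near the critical point", (i)–(iv),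
  combining the arm exponents with Kesten, *Scaling relations for 2D-percolation*, Comm. Math.
  Phys. 109 (1987), 109–156, Thms. 1–2 and Cor. 1; Kesten's Cor. 1 gives `γ = γ'` and `ν = ν'`,
  i.e. the same exponents on both sides of `p_c`).

Theorem numbering of Smirnov–Werner 2001 used in this file (and in its companions
`ArmExponentsTwoArm.lean`, `ArmExponentsFourArm.lean`, `NearCriticalCorrelationLength.lean`) is
that of the arXiv text `math/0109120`, checked against the held copy: Thm. 1 (§2) = behaviour
near the critical point, items (i) `θ`, (ii) `χ`, (iii) `ξ`, (iv) `ξ*`; Remark 2 = changing the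
colours; Thm. 3 (§3) = half-plane exponents `j(j+1)/6`; Thm. 4 (§4) = plane exponents
`(j² - 1)/12`, `j ≥ 2`; Remarks 5–6 (§4.1). (Earlier revisions of this file cited the plane
exponents as "Thm. 1" and the near-critical exponents as "Thm. 2"; in the arXiv text Thm. 1 is
the near-critical theorem and no item is numbered "Theorem 2", so those locators were corrected
on 2026-08-15 without touching any statement.)

Design choices.
* The `o(1)` in every exponent is rendered by the logarithmic-ratio limits of
  `CorrelationDecay.lean`: `HasDecayExponent u κ` is `log (u n) / log n → -κ`,
  `HasRightPowerLaw f x₀ κ` is `log (f x) / log (x - x₀) → κ` along `𝓝[>] x₀`, and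
  `HasLeftPowerLaw f x₀ κ` is `log (f x) / log (x₀ - x) → κ` along `𝓝[<] x₀`. These are exactly
  the `= n^{-κ + o(1)}` / `= |x - x₀|^{κ + o(1)}` assertions of the sources. The one-arm
  statement uses the prelude alias `HasOneArmExponent` (an `abbrev` for `HasDecayExponent`),
  the multi-arm statements the prelude predicate `HasArmExponent`.
* Real-parameter statements use the prelude wrappers `triThetaReal`, `triCorrLengthReal`,
  `triMeanClusterSizeReal` (constant extension outside `[0, 1]` via `Set.projIcc`, invisible to
  one-sided limits at `1/2`), so no `projIcc` appears in a statement.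
* The multi-arm statements quantify `∃ r₁, ∀ r₀ ≥ r₁` as in Smirnov–Werner 2001, Thm. 4 ("for
  all large enough `r` (i.e. `r > const(j)`)"): for small `r₀` the arm event may be empty for
  lattice reasons. The colour sequences `![true, false]` and `![true, false, true, false]` are
  the standard polychromatic choices; by Smirnov–Werner 2001, §4 (the paragraph preceding
  Thm. 4: "exponents are the same for `j` crossings of any prescribed colours in any prescribed
  order, as long as colours are not all the same"; Bollobás–Riordan 2006, Ch. 7, before (54))
  the exponent depends only on the number of arms once both colours occur, and `armEvent` does
  not impose the cyclic order (see `ArmEvents.lean`). Smirnov–Werner's annuli are bounded by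
  (discretised) circles; here they are the lattice hexagons `Λ_R \ Λ_r` (SW, §3: "One could as
  well take a semi-hexagonal or a triangular shape instead of the semi-circles"); the two
  families of annuli are nested within constant factors of the radii, which is invisible in an
  `R^{-α + o(1)}` statement quantified over all large inner radii.
* `triMeanClusterSizeReal` is `ℝ≥0∞`-valued: it is the *finite-cluster* mean size
  `χ^f(p) = E_p[|C|; |C| < ∞]`, which equals the mean cluster size `χ(p) = E_p|C|` for
  `p < 1/2` and is finite for every `p ≠ p_c` (Kesten 1987, (1.16)); hence the `χ` statement is
  two-sided, like the inventory's `|p - 1/2|`. The statement applies `ENNReal.toReal`, whose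
  junk value `∞ ↦ 0` is never met on a punctured neighbourhood of `1/2`.
* Naming: the S15 theorem names `oneArm_exponent`, `twoArm_exponent`, `fourArm_exponent` are
  the ones fixed by the outline's work item; they concern the triangular-lattice events
  `triOneArm` / `armEvent` (not the `ℤ^d` bond objects `oneArm`, `oneArmProb` of the prelude).
  Recorded as naming debt (`triOneArm_exponent` etc. would be more uniform with S16).
* `triCorrLength` is Grimmett's finite-cluster correlation length (see `ArmEvents.lean` for the
  alternatives); all standard correlation lengths are `≍`-equivalent near `p_c` in two
  dimensions (Kesten 1987, Cor. 1), so the exponent `ν = 4/3` is insensitive to this choice.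

Mathlib search: Mathlib has no percolation, arm events or critical exponents
(`rg -i "percolation|arm exponent|one-arm"` in Mathlib finds nothing relevant); everything used
here comes from the accepted H21 preludes `CorrelationDecay`, `Percolation`, `TriangularLattice`,
`ArmEvents`. This file introduces no definitions.

## Proof status of the S15 arm exponents (review of `twoArm_exponent`, 2026-08-15)

`twoArm_exponent` was reviewed with the source open (arXiv text of Smirnov–Werner 2001, §4,
Thm. 4 and pp. 7–9; Bollobás–Riordan 2006, Ch. 7, (51)–(55) and the discussion following
(55)). Findings, recorded here so that later seats need not redo them:
* **The statement is faithful** to Thm. 4 with `j = 2`: `(j² - 1)/12 = 1/4`; with two arms "not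
  all of the same colour" means one open and one closed arm, i.e. the colour sequence
  `![true, false]` (the cyclic order of two arms is vacuous); "for all large enough `r`" is the
  prefix `∃ r₁, ∀ r₀ ≥ r₁`; `R^{-1/4 + o(1)}` is the log-ratio limit of `HasArmExponent`;
  hexagonal instead of circular annuli (previous bullet list). It is a published theorem, not a
  conjecture, and it is the original crit-perc.S15 statement, not a decomposition product.
* **It has no short proof.** Smirnov–Werner (§4, p. 7: "Exactly as its half-plane counterpart,
  the theorem follows from the two observations") derive Thm. 4 from (16)/(9): the existence of
  the conformally invariant scaling limit `b'_j(R/r) = lim_ρ b_j(ρr, ρR)` (Smirnov's theorem,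
  their refs. [S, Sprep]) together with the `SLE₆` annulus exponent
  `b_j^{sle}(R) = R^{-(j²-1)/12 + o(1)}` ((13), from Lawler–Schramm–Werner, their (14) =
  [LSW1, Thm. 3.1]), and from (10): quasi-multiplicativity of the crossing probabilities along
  the scales `R^l` (§4.2, after Kesten 1987 and Kesten–Sidoravicius–Zhang). The first input is
  a theory (convergence of the exploration process to `SLE₆` plus `SLE₆` exponent computations)
  with no counterpart in Mathlib; no `SLE`-free derivation of the exponent `1/4` is printed in
  the sources.
* **The tree mirrors this reduction and proves everything elementary in it.**
  `twoArm_exponent_of_facts` (`ArmExponentsTwoArm.lean`) proves `twoArm_exponent` from the named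
  facts `SmirnovWerner2001_twoArm_scalingLimit` ((16) + (9) for `j = 2`) and
  `Nolin2008_twoArm_quasiMult` ((10)); `twoArm_exponent_of_scalingLimit_of_separation`
  (`ArmSeparationProofs.lean`) replaces the latter by `Nolin2008_twoArm_separation`;
  `SmirnovWerner2001_twoArm_scalingLimit_iff` (`ArmExponentsTwoArmProofs.lean`) shows the
  scaling-limit fact is exactly (16) and (9) read on integer annuli. Sub-multiplicativity,
  monotonicity in both radii, positivity, the RSW a-priori bounds and the product-of-scales
  argument of SW p. 5 are proved there. Hence `twoArm_exponent_holds` is expected exactly when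
  `SmirnovWerner2001_twoArm_scalingLimit` (Smirnov's theorem with the `SLE₆` exponent) and
  `Nolin2008_twoArm_separation` are discharged, and not before; the fact is correctly cut and
  should neither be re-split nor restated.
* `fourArm_exponent` (Thm. 4, `j = 4`) has the same status; its reductions and what exactly is
  missing are recorded in its own section below (the last one of this docstring);
  `oneArm_exponent` is Lawler–Schramm–Werner's theorem (SW §4.3 only sketch it), reduced in
  `OneArmLSW.lean` / `OneArmLSWProofs.lean` (next section).

## Proof status of `oneArm_exponent` (review, 2026-08-15)

`oneArm_exponent` was reviewed with the source open (arXiv text `math/0108211` of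
Lawler–Schramm–Werner 2002: §1 with Thm. 1.1 and Thm. 1.2, §2 with Thm. 2.1, (2.1)–(2.10) and
Lemmas 2.2–2.3, §3 "The discrete exponent"; theorems are numbered within sections as in the
EJP version). Findings, recorded here so that later seats need not redo them:
* **The statement is faithful** to Thm. 1.1: "For critical site percolation on the standard
  triangular grid in the plane, `P[0 ↔ C_R] = R^{-5/48 + o(1)}`, `R → ∞`", `0 ↔ C_R` being "an
  open path from the origin to the circle `C_R` of radius `R` around the origin". The tree's
  event `triOneArm n` is `0 ↔ ∂Λ_n` inside the lattice hexagon `Λ_n = triBall n` instead of the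
  Euclidean circle; since `(√3/2) d_𝕋(0, x) ≤ ‖x‖ ≤ d_𝕋(0, x)` and both families of events are
  monotone in the radius, the two log-ratio limits coincide, and this passage is not merely
  asserted but performed in the tree: `oneArm_exponent_of_LSW` (`OneArmLSW.lean`) proves the
  hexagon form from bounds on LSW's circular annulus crossings `C(rR, R)`. `R^{-5/48 + o(1)}` is
  the log-ratio limit `HasDecayExponent … (5/48)`. It is a published theorem (LSW §1: "In this
  paper we prove"; unconditional after Smirnov 2001, see their Acknowledgements), and it is the
  original crit-perc.S15 statement, not a decomposition product (it has no split parent).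
* **It has no short proof.** LSW §1: the result "is based on the recent proof by Stanislav
  Smirnov that the scaling limit of this percolation process exists and is described by" `SLE₆`;
  Thm. 1.1 "will appear as a corollary" (§3) of Thm. 1.2, the exponent `5/48` of the scaling
  limit `Q` of the clusters meeting the unit circle, whose proof (§2) is radial `SLE₆`: Smirnov's
  description of `Q(θ)` (Thm. 2.1), the radial Loewner equation and the renewal identity
  (2.5)–(2.10), the PDE of Lemma 2.2, the Neumann estimate of Lemma 2.3, the eigenfunction
  comparison (2.17) and Koebe's theorem. No `SLE`-free derivation of `5/48` is printed anywhere.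
* **The tree mirrors this and proves everything but the `SLE₆` input.** §3 is proved in full
  (`OneArmLSW.lean`: Harris chains, independence of disjoint annuli, first-exit surgery, the
  `o(1)` bookkeeping) and its RSW input is discharged (`BollobasRiordan2006_openCircuit_holds`,
  `OneArmLSWProofs.lean`), so that
  `oneArm_exponent_of_annulusCrossing : LawlerSchrammWerner2002_annulusCrossing → oneArm_exponent`
  (`OneArmLSWProofs.lean`): **the discharge `oneArm_exponent_holds` is this one line applied to
  `LawlerSchrammWerner2002_annulusCrossing_holds`, once the latter exists, and nothing shorter is
  available.** The continuum input `LawlerSchrammWerner2002_annulusCrossing` (Thm. 1.2 with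
  (3.1); an existing named fact of `OneArmLSW.lean`, faithful and weaker than printed) is in turn
  worked bottom-up in the tree: the analytic half of §2 is proved (`isHittingPDEData_lswHit`,
  `OneArmHittingPDEAnalytic.lean`: Lemma 2.2, (2.3), (2.12) for the semigroup solution; the
  uniqueness theorem `eq_lswHit_two_pi_of_renewal`, `OneArmTraceIdentification.lean`), and both
  that fact and `oneArm_exponent` itself are reduced to ONE probabilistic hypothesis at the
  subsequential weak limits `ν` of the hull laws `lswLaw R` (`OneArmScalingLimit.lean`) — the
  trace identification `u(2π, t) = ν{K | 𝔯(K) ≤ e^{-t}}` (`oneArm_exponent_of_subseqTrace`,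
  `OneArmFromTrace.lean`; `LawlerSchrammWerner2002_annulusCrossing_of_subseqTrace`,
  `OneArmAnnulusCrossingFromTrace.lean`), equivalently LSW's own inputs (2.10) and Lemma 2.3 at
  those limits (`oneArm_exponent_of_subseqRenewal`, `OneArmTraceIdentification.lean`). That
  hypothesis is Thm. 2.1 read through the radial Loewner equation: it rests on the convergence of
  the exploration path to `SLE₆` (`convergesInLawToSLE_six_triInterface`, crit-perc.S04, an
  unproved named fact of `InterfaceScalingLimit.lean`; its tightness layer
  `isTightLaws_map_triInterface_holds` is proved) and on the full-plane passage from one interface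
  to the clusters meeting a circle (Camia–Newman; `exists_isCNLFamily_tendsto`, `CLE6.lean`,
  unproved) — a theory, not an inline lemma.
* Hence `oneArm_exponent` is correctly cut and must be neither re-split nor restated nor merged;
  a prove seat holding it can only end `blocked-on: LawlerSchrammWerner2002_annulusCrossing`,
  which is the right state until that fact is discharged; the many in-tree consumers
  (`KestenScaling*.lean`, `NearCritical*.lean`, `MeanClusterSize*.lean`) take it as the
  hypothesis `(h₁ : oneArm_exponent)` meanwhile.

## Proof status of `fourArm_exponent` (review, 2026-08-15)

`fourArm_exponent` was reviewed with the source open (arXiv text `math/0109120` of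
Smirnov–Werner 2001: §4, pp. 7–9, with Thm. 4, (9)–(16), Remarks 5–6 and §4.2
"Multiplicativity"; Bollobás–Riordan 2006, Ch. 7, (52)–(54)). Findings, recorded here so that
later seats need not redo them:
* **The statement is faithful** to Thm. 4 with `j = 4`: `(j² - 1)/12 = 15/12 = 5/4`, the value
  singled out in the sentence following the theorem ("In particular,
  `P(A_R^2) = b_4(2, R) = R^{-5/4 + o(1)}`": four crossings of alternate colours, i.e. two
  disjoint clusters crossing the annulus). SW's `b_j(r, R)` is the probability of `j` disjoint
  crossings of `A(r, R)` "not all of the same colour"; the tree's event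
  `armEvent ![true, false, true, false] r₀ R` prescribes the colours (two open and two closed
  arms) but not their cyclic order (`ArmEvents.lean`; it is the union of the alternating and the
  adjacent pattern, `ArmPatternsFourArm.lean`), and SW, p. 7: "One can also prescribe colours of
  the crossings and their order, which will change `b_j` up to a multiplicative constant (we will
  justify this rigorously later), preserving the theorem below" — a constant is invisible in an
  `R^{-5/4 + o(1)}` statement. "For all large enough `r` (i.e. `r > const(j)`)" is the prefix
  `∃ r₁, ∀ r₀ ≥ r₁`; `R^{-5/4 + o(1)}` is the log-ratio limit of `HasArmExponent … (5 / 4)`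
  (`log P_{1/2}(armEvent κ r₀ R) / log R → -5/4`); hexagonal instead of circular annuli as in
  the design notes above. It is a published theorem, not a conjecture, and it is the original
  crit-perc.S15 statement of this file, not a decomposition product (it has no split parent);
  some thirty Literature files (`KestenScaling*.lean`, `NearCritical*.lean`,
  `MeanClusterSize*.lean`, `TriTheta*`/`TriCorrLength*FromFacts.lean`, …) take it as the
  hypothesis `(h₄ : fourArm_exponent)`.
* **It has no short proof.** SW, p. 7: "Exactly as its half-plane counterpart, the theorem
  follows from the two observations which will be discussed below", namely (9), obtained from
  (12)–(15), and (10), whose proof also uses (16). The first observation is a theory absent from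
  the tree: (12)
  `lim_ρ b_j^{ep}(ρ r, ρ R) = b_j^{sle}(r, R)`, the convergence to `SLE₆` of the exploration
  process in the universal cover of the annulus stopped at the disconnection time ("As
  discussed, the law of the chordal exploration process converges (as mesh goes to zero) to
  that of `SLE₆`" — Smirnov's theorem, crit-perc.S04, in the tree the unproved named fact
  `convergesInLawToSLE_six_triInterface` of `InterfaceScalingLimit.lean` — used together with
  the a priori six-arm bound (11)); (13)–(14) `b_j^{sle}(R) = R^{-(j²-1)/12 + o(1)}` from the
  annular `SLE₆` exponents `ν(λ) = (4λ + 1 + √(1 + 24λ))/8` of Lawler–Schramm–Werner (their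
  refs. [LSW1, Thm. 3.1], [LSW2]; for `j = 4`, `b_4^{sle}(R) = E[1_{σ<T} a_2^{sle}(S)]` with the
  half-plane two-arm exponent `λ = 2·3/6 = 1` of Thm. 3 and `ν(1) = 5/4`), of which the tree has
  no trace beyond the one-arm case (the radial `SLE₆` computation of the exponent `5/48` in the
  `OneArm*.lean` files): no annular `SLE₆` exponent `ν(λ)` and no Brownian intersection exponent
  is declared anywhere in `Literature/`; (15) `b_j^{ep} ≤ b_j`, with the converse up to a
  constant for even `j` (Remark 6); and (16) `b'_j(R/r) = lim_ρ b_j(ρ r, ρ R)` ("It follows from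
  [Sprep]": the full scaling limit — in the tree the unproved Camia–Newman fact
  `exists_isCNLFamily_tendsto` of `CLE6.lean` — and the measurability of arm events with
  respect to it, Garban–Pete–Schramm, J. Amer. Math. Soc. 26 (2013), Lemma 2.9). No `SLE`-free
  derivation of the value `5/4` is printed anywhere. The second observation (10) is Kesten's
  arm separation (§4.2: "Standard (but delicate) techniques based on RSW theory (cf. [Kpaper])",
  i.e. Kesten 1987; Nolin 2008, Thm. 11 and Prop. 17), elementary but long: its two-arm case is
  the programme `ArmSeparation*.lean` of this directory (over seventy files, ending in
  `Nolin2008_twoArm_separation_holds`, `ArmSeparationFinalProofs.lean`).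
* **The tree mirrors this reduction and proves everything elementary in it except four-arm
  separation.** PROVED: the product-of-scales assembly of SW p. 5 for an abstract two-radius
  sequence (`ArmExponentAssembly.hasDecayExponent_of_scales`, `ArmExponentsFourArm.lean`) with
  its specialisations `fourArm_exponent_of_scaleBounds`, `fourArm_exponent_of_scalingLimit`,
  `fourArm_exponent_of_asympBounds` (hypothesis (A) = (16) + (9) for `j = 4` spelled out in the
  theorem, (B) = the named fact `Werner2009_fourArm_quasiMult`); the passage from SW's real
  dilations to integer data (`fourArm_exponent_of_limits_nat`, `ArmExponentsFourArmProofs.lean`);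
  positivity and the RSW a priori bounds (`critFourArmProb_pos`, `exists_rpow_le_altFourArmProb`);
  Kesten's gluing for four arms, i.e. (10) at `p = 1/2` FROM four-arm separation
  (`critFourArmProb_quasiMult_of_separation`, `ArmSeparationFourArmProofs.lean`, on the fenced
  event `sepFourArm` of `ArmSeparationFourArm.lean`); Nolin's colour switching for four arms
  (`fourArm_flip` and `fourArm_bridge_of_landing`, `FlipFourArm.lean`;
  `critFourArm_separation_of_alt`, `ArmPatternsFourArm.lean`). The end form is
  `fourArm_exponent_of_altLimits` (`ArmExponentsFourArmInputs.lean`): `fourArm_exponent` from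
  exactly four published inputs taken as hypotheses in their printed shapes — (16)₄, a scaling
  limit `g(R/r)` of the alternating four-arm probabilities `P_{1/2}(altFourArm (ρ r) (ρ R))`
  (Garban–Pete–Schramm 2013, Lemma 2.9); (9)₄, `log g(n) / log n → -5/4` (SW (9) = (12) + (13) +
  (15)); Sep₄, `c · P_{1/2}(altFourArm n N) ≤ P_{1/2}(sepFourArm n N)` for `n₀ ≤ n`, `2n ≤ N`
  (Nolin 2008, Thm. 11 for `j = 4`, `σ = BWBW`); Land₄,
  `c · P_{1/2}(adjFourArm n N) ≤ P_{1/2}(landedFourAdj n N)` (the same theorem for `σ = BBWW`,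
  external landing only). Equivalently, `fourArm_exponent_of_separation`
  (`ArmSeparationFourArmProofs.lean`) assembles it from (16) and (9) read on integer data for
  `π₄ = critFourArmProb` itself and separation for `π₄`. NOT in the tree: any of these four
  inputs, whether as a theorem or as a named fact. In particular the four-arm twin of
  `SmirnovWerner2001_twoArm_scalingLimit` — (16) + (9) for `j = 4`, hypothesis `hA` of
  `fourArm_exponent_of_scalingLimit` — has never been vendored.
* **`Werner2009_fourArm_quasiMult` is not what this fact is waiting for.** That named fact
  (`NearCriticalFourArmFacts.lean`; Werner 2009, Lecture 6, Cor. 6.2: quasi-multiplicativity of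
  the order-free four-arm probability `fourArmProbAt t`, uniformly for `t ∈ [1/2, 1/2 + δ)`
  below `L(t)`; unproved, and reduced to near-critical four-arm separation by
  `Werner2009_fourArm_quasiMult_of_separation`, `NearCriticalFourArmQuasiMult.lean`) is one
  sufficient form of input (B) only: its discharge would leave (A)₄ = (16)₄ + (9)₄ untouched,
  and conversely Sep₄ + Land₄ at `p = 1/2` supply (B) without it
  (`critFourArmProb_quasiMult_of_separation`).
* Hence `fourArm_exponent` is correctly cut and must be neither re-split nor restated nor
  merged; `fourArm_exponent_holds` is `fourArm_exponent_of_altLimits` (or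
  `fourArm_exponent_of_scalingLimit`) applied to its inputs once they exist in the tree, and
  nothing shorter is available. In dependency order the missing pieces are: the `SLE₆` input
  `convergesInLawToSLE_six_triInterface` (crit-perc.S04) and the full scaling limit
  `exists_isCNLFamily_tendsto` built on it; the annular `SLE₆` exponents of
  Lawler–Schramm–Werner with SW's (12)–(15) for `j = 4`, i.e. a named fact in the shape of
  hypothesis `hA` of `fourArm_exponent_of_scalingLimit` (or of `hlim` + `hexp` of
  `fourArm_exponent_of_altLimits`), which no file states yet; and four-arm separation
  Sep₄ + Land₄ (Nolin 2008, Thm. 11 for `j = 4`), or else `Werner2009_fourArm_quasiMult`. Until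
  the continuum input exists, a prove seat holding this fact can only park on the `SLE₆` input
  `convergesInLawToSLE_six_triInterface`, exactly as `oneArm_exponent` parks on
  `LawlerSchrammWerner2002_annulusCrossing` and `twoArm_exponent` on
  `SmirnovWerner2001_twoArm_scalingLimit`.

## Proof status of `triMeanClusterSize_exponent` (review, 2026-08-15)

`triMeanClusterSize_exponent` (crit-perc.S16, `γ = 43/18`) was reviewed with the sources open
(arXiv text `math/0109120` of Smirnov–Werner 2001: §2, p. 4, the definitions of `θ`, `χ`, `ξ`,
`ξ*`, Thm. 1 (i)–(iv) and the paragraph following it; arXiv text `0711.4948` of Nolin 2008: §7.2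
Thm. 31, §7.3 Prop. 32, §7.5 Lemma 42 and Prop. 43, all in the arXiv numbering; Kesten 1987 is
not held, acquisition request acq-02765, and is used here only through the attributions printed
in these two texts). Findings, recorded here so that later seats need not redo them:
* **The statement is faithful** to Thm. 1 (ii): "(ii) When `p → 1/2`,
  `χ(p) = (p - 1/2)^{-43/18 + o(1)}`", where "`χ(p) = E_p[N 1_{N<∞}]`. This corresponds to the
  average cardinality of finite clusters", `N` being "the cardinality of the cluster `C`
  containing the origin" (SW, §2, p. 4); equivalently Nolin 2008, Thm. 31, third item: "When
  `p → 1/2`, `χ(p) ≈ |p - 1/2|^{-43/18}`" with "`χ(p) = E_p[|C(0)|; |C(0)| < ∞]` the average size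
  of a finite cluster" (`≈` is Nolin's logarithmic equivalence). The tree's `triMeanClusterSize p`
  is `∫⁻ 1_{|C(0)| < ∞} |C(0)| dP_p` (`ArmEvents.lean`), i.e. this `χ`. The limit `p → 1/2` is
  two-sided in both sources (only item (i), `θ`, is one-sided), and the conjunction
  `HasRightPowerLaw … (1/2) (-43/18) ∧ HasLeftPowerLaw … (1/2) (-43/18)`
  (`log χ^f(p) / log (p - 1/2) → -43/18` along `𝓝[>] (1/2)` and
  `log χ^f(p) / log (1/2 - p) → -43/18` along `𝓝[<] (1/2)`) is exactly
  `log χ^f(p) / log |p - 1/2| → -43/18` as `p → 1/2`, `p ≠ 1/2`. `ENNReal.toReal` is applied to a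
  quantity that is finite on a punctured neighbourhood of `1/2`, and this finiteness is not
  assumed but comes out of the tree's own upper bound from the same leaves
  (`triMeanClusterSize_le_rpow_at`, `MeanClusterSizeUpperBound.lean`:
  `χ^f(p) ≤ C_η L_ε(p)^{43/24 + η}` near `1/2`), so the junk value `∞ ↦ 0` is never met. It is
  a published theorem — SW, p. 4: "It has been shown by Kesten in [Kpaper] … that all these
  results hold provided that", at `p = 1/2`, (1) `P[A_R^1] = R^{-5/48 + o(1)}` and (2)
  `P[A_R^2] = R^{-5/4 + o(1)}`; (1) is Lawler–Schramm–Werner's Thm. 1.1, here `oneArm_exponent`,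
  and (2) is SW Thm. 4 for `j = 4`, here `fourArm_exponent`; a complete proof for site
  percolation on `𝕋` is Nolin 2008, §7 — and it is the original crit-perc.S16 statement of this
  file, not a decomposition product (it has no split parent, and no Literature file takes it as
  a hypothesis: it is a terminal statement of the family).
* **It has no short proof, and none that avoids either arm exponent.** Nolin's proof of Thm. 31
  (§7.5): `χ(p) ≍ L(p)² π₁²(L(p))` (Prop. 43, i.e. Lemma 42 at `t = 0`: the sites at distance
  `≫ L(p)` contribute negligibly by the exponential decay uniform in `p` beyond `L(p)`, and below
  `L(p)` the one-arm probabilities are comparable to the critical ones), then "`χ(p) ≈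
  L(p)² [L(p)^{-5/48}]² ≈ [|p - 1/2|^{-4/3}]^{86/48} ≈ |p - 1/2|^{-43/18}`", using the one-arm
  exponent `5/48` and `ν = 4/3`, the latter read off Kesten's relation
  `|p - 1/2| L_ε(p)² π₄(L_ε(p)) ≍ 1` (Prop. 32, "[Ke4, SmW]") and the four-arm exponent `5/4`
  (§7.3). So the discharge needs BOTH `SLE₆` exponents reviewed in the two sections above —
  `oneArm_exponent` (enters as `π₁²`, exponent `2 · 5/48`) and `fourArm_exponent` (enters through
  `ν = 1/(2 - 5/4) = 4/3`) — besides Kesten's near-critical theory; `(2 - 10/48) · (4/3) = 43/18`.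
* **The tree mirrors Nolin's §7 and proves everything in it except the two arm exponents and
  near-critical four-arm separation.** PROVED: `χ^f(p) = Σ_x P_p(0 ↔ x, |C(0)| < ∞)`
  (`triMeanClusterSize_eq_tsum`, `MeanClusterSizeTwoPoint.lean`); the upper bound
  `χ^f(p) ≤ C_η L_ε(p)^{43/24 + η}` (`triMeanClusterSize_le_rpow_at`,
  `MeanClusterSizeUpperBound.lean`: Lemma 42 at `t = 0` with the radius decay beyond `L_ε`) and
  the lower bound `χ^f(p) ≥ c L_ε(p)² π₁(L_ε(p))²` (`triMeanClusterSize_ge_sq_at`,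
  `MeanClusterSizeLowerBound.lean`: RSW circuits below `L_ε`), both on both sides of `1/2` and
  both from one-arm stability below `L_ε`; the real-analysis assembly
  `log χ^f / log L_ε → 43/24`, `log L_ε / log |p - 1/2| → -4/3`, `(43/24) · (4/3) = 43/18`
  (`triMeanClusterSize_exponent_of_powerBounds`, `MeanClusterSizeExponentAssembly.lean`); the
  uniform exponential decay beyond `L_ε` (`Nolin2008_lemma39_at_holds_small`,
  `NearCriticalRSWStart.lean`); Kesten's relation (`Nolin2008_prop34`) and one-arm stability on
  both sides of `1/2` (`Nolin2008_thm27_oneArm`, Nolin's Thm. 27 of the EJP numbering for `j = 1`)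
  FROM the four near-critical facts of Kesten's arm calculus in W. Werner's form (PCMI 2009,
  Lecture 6: Cor. 6.2, §3 third estimate, §3 ¶1, proof of Lemma 6.2;
  `Nolin2008_prop34_of_facts`, `KestenScalingFromFourFacts.lean`;
  `Nolin2008_thm27_oneArm_of_facts4`, `NearCriticalOneArmFromFourFacts.lean`); two of those four
  facts outright
  (`Werner2009_fourArm_lowerBound_holds`, `FiveArmLowerBound.lean`;
  `Werner2009_halfPlane_twoArm_holds`, `HalfPlaneTwoArmRadiiNearCritical.lean`); and the other
  two FROM near-critical four-arm separation (`Werner2009_fourArm_quasiMult_of_separation`,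
  `NearCriticalFourArmQuasiMult.lean`; `Werner2009_pivotal_lowerBound_of_separation`,
  `PivotalLowerBoundFromSeparation.lean`). The end forms are
  `triMeanClusterSize_exponent_of_facts3` (`MeanClusterSizeExponentFromFourFacts.lean`) and
  `triMeanClusterSize_exponent_of_facts2` (`MeanClusterSizeExponentFromSeparation.lean`):
  **`triMeanClusterSize_exponent` from exactly four undischarged named facts of the tree —
  `oneArm_exponent`, `fourArm_exponent`, `Werner2009_fourArm_quasiMult` (Werner 2009, Lecture 6,
  Cor. 6.2; `NearCriticalFourArmFacts.lean`) and `Werner2009_pivotal_lowerBound` (proof of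
  Lemma 6.2; `NearCriticalBoundaryFacts.lean`)**; equivalently
  `triMeanClusterSize_exponent_of_separation` (same file): from the two arm exponents and ONE
  explicit hypothesis, the comparability `c · π̂_t(n, N) ≤ P_t(sepFourArm n N)` below `L(t)`
  (Nolin 2008, Thm. 11 of the EJP numbering for `j = 4`, uniformly in `p`; Kesten 1987), which no
  file states as a named fact; and `triMeanClusterSize_exponent_of_scalingLimits_of_separation`
  (`MeanClusterSizeExponentKernel.lean`) spells out the complete list of published inputs: LSW's
  scaling limit with their Thm. 1.2 (for (1)), SW's (16) + (9) for `j = 4` (for (2)), and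
  near-critical four-arm separation. NOT in the tree: any of these, as a theorem. The separation
  theorem is elementary but long — its critical two-arm analogue is the programme
  `ArmSeparation*.lean` of this directory (78 files, about 25 600 lines, ending in
  `Nolin2008_twoArm_separation_holds`, `ArmSeparationFinalProofs.lean`) — and the two exponents
  are the `SLE₆` theory described in the two preceding sections.
* Hence `triMeanClusterSize_exponent` is correctly stated and correctly cut; it must be neither
  re-split nor restated nor merged (there is no parent to merge it into), and it is not an open
  problem. `triMeanClusterSize_exponent_holds` is `triMeanClusterSize_exponent_of_facts3` (or
  `…_of_facts2`) applied to the corresponding `_holds` theorems once they exist — in a leaf file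
  importing `MeanClusterSizeExponentFromSeparation.lean`, since `ArmExponents.lean` is upstream
  of the whole reduction (`KestenScaling.lean` imports it) — and nothing shorter is printed
  anywhere: both published proofs of `γ = 43/18` for `𝕋` (SW 2001, §2, via Kesten 1987; Nolin
  2008, §7.5) pass through `ν = 4/3`, i.e. through the four-arm exponent `5/4`, and through the
  one-arm exponent `5/48`. Until those two facts are discharged, a prove seat holding this fact
  can only end `blocked-on:` one of its four undischarged prerequisites (all of them existing
  named facts, none inline-sized), exactly as the three S15 facts above park on their `SLE₆`
  inputs.
-/

noncomputable section

open Filter Topology MeasureTheory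
open scoped ENNReal

namespace Literature.Probability.Percolation

open LatticeModels

/-! ### crit-perc.S15: arm exponents at criticality -/

/-- **crit-perc.S15** (one-arm exponent; Lawler–Schramm–Werner, Electron. J. Probab. 7 (2002)
= arXiv:math/0108211, Thm. 1.1: "For critical site percolation on the standard triangular grid
in the plane, `P[0 ↔ C_R] = R^{-5/48 + o(1)}`, `R → ∞`", `C_R` the circle of radius `R` about
the origin). For critical site percolation on the triangular lattice,
`P_{1/2}(0 ↔ ∂Λ_n) = n^{-5/48 + o(1)}` as `n → ∞`; here `0 ↔ ∂Λ_n` is the one-arm event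
`triOneArm n` (the origin is joined inside `Λ_n = triBall n` by an open path to
`∂Λ_n = triSphere n`) and the `o(1)` in the exponent is the log-ratio limit
`log P_{1/2}(0 ↔ ∂Λ_n) / log n → -5/48` of `HasDecayExponent` (through the prelude alias
`HasOneArmExponent`); lattice hexagons `Λ_n` replace LSW's circles `C_R`, which are nested
within the factor `√3/2` of the radii and give the same exponent. Proof status: see the module
docstring — proved in the tree from the single named fact `LawlerSchrammWerner2002_annulusCrossing`
(LSW Thm. 1.2 with (3.1), the `SLE₆` input) by `oneArm_exponent_of_annulusCrossing`
(`OneArmLSWProofs.lean`), which also performs the passage from circles to hexagons.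
[cite: LawlerSchrammWernerEJP2002, Thm. 1.1] -/
def oneArm_exponent : Prop :=
  HasOneArmExponent (fun n => (triSitePercolation half).real (triOneArm n)) (5 / 48)

/-- **crit-perc.S15** (polychromatic two-arm exponent; Smirnov–Werner, Math. Res. Lett. 8
(2001) = arXiv:math/0109120, Thm. 4 "Plane exponents" with `j = 2`: "For any `j ≥ 2`, and for
all large enough `r` (i.e. `r > const(j)`), `b_j(r, R) = R^{-(j²-1)/12 + o(1)}` when `R → ∞`",
`b_j(r, R)` the probability of `j` disjoint crossings of the annulus `A(r, R)` not all of the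
same colour; Bollobás–Riordan 2006, Ch. 7, (54)). For critical site percolation on `𝕋` and every
large enough inner radius `r₀`, the probability that the annulus `Λ_R \ Λ_{r₀}` is crossed by two
vertex-disjoint arms, one open and one closed, is `R^{-1/4 + o(1)}` as `R → ∞`
(`(j² - 1)/12 = 1/4`; for two arms "not all of the same colour" is exactly "one open, one
closed", and their cyclic order is vacuous); the `o(1)` is the log-ratio limit of
`HasDecayExponent` underlying `HasArmExponent`. Proof status: see the module docstring — proved
in the tree from the named facts `SmirnovWerner2001_twoArm_scalingLimit` (Smirnov's theorem with
the `SLE₆` exponent) and `Nolin2008_twoArm_separation` (`twoArm_exponent_of_scalingLimit_of_separation`). [cite: SmirnovWernerMRL2001, Thm. 4 (Plane exponents), j = 2 (arXiv:math/0109120 numbering)] [cite: BollobasRiordan2006, Ch. 7, (54)] -/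
def twoArm_exponent : Prop :=
  ∃ r₁ : ℕ, ∀ r₀ ≥ r₁, HasArmExponent ![true, false] r₀ (1 / 4)

/-- **crit-perc.S15** (polychromatic four-arm exponent; Smirnov–Werner, Math. Res. Lett. 8
(2001) = arXiv:math/0109120, Thm. 4 "Plane exponents" with `j = 4` and the sentence following
it, `P[A_R^2] = b_4(2, R) = R^{-5/4 + o(1)}`, which is §2, (2); Kesten, Comm. Math. Phys. 109
(1987), §1). For critical
site percolation on `𝕋` and every large enough inner radius `r₀`, the probability that the
annulus `Λ_R \ Λ_{r₀}` is crossed by four vertex-disjoint arms of alternating colours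
open/closed/open/closed is `R^{-5/4 + o(1)}` as `R → ∞` (`(j² - 1)/12 = 5/4`); the `o(1)` is
the log-ratio limit of `HasDecayExponent` underlying `HasArmExponent`. (The cyclic order of the
colours is not imposed by `armEvent`; by Smirnov–Werner 2001, §4, the paragraph preceding
Thm. 4 — "exponents are the same for `j` crossings of any prescribed colours in any prescribed
order, as long as colours are not all the same" — the exponent of any polychromatic four-arm
event is `5/4`; likewise Bollobás–Riordan 2006, Ch. 7, before (54).) Proof status: see the
module docstring — reduced in the tree (`fourArm_exponent_of_altLimits`,
`ArmExponentsFourArmInputs.lean`; `fourArm_exponent_of_scalingLimit`, `ArmExponentsFourArm.lean`)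
to Smirnov–Werner's two observations for `j = 4`, the scaling limit with its `SLE₆` exponent
((16) + (9), resting on `convergesInLawToSLE_six_triInterface`) and four-arm separation ((10);
Kesten's gluing and Nolin's colour switching are proved), neither of which is in the tree yet. [cite: SmirnovWernerMRL2001, Thm. 4 (Plane exponents), j = 4, and the paragraph preceding it (arXiv:math/0109120 numbering)] [cite: BollobasRiordan2006, Ch. 7, (54) and (52)] -/
def fourArm_exponent : Prop :=
  ∃ r₁ : ℕ, ∀ r₀ ≥ r₁, HasArmExponent ![true, false, true, false] r₀ (5 / 4)

/-! ### crit-perc.S16: near-critical exponents `β = 5/36`, `ν = 4/3`, `γ = 43/18` -/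

/-- **crit-perc.S16** (exponent `β = 5/36`; Smirnov–Werner, Math. Res. Lett. 8 (2001) =
arXiv:math/0109120, Thm. 1 "Behaviour near the critical point", (i): "When `p → 1/2+`,
`θ(p) = (p - 1/2)^{5/36 + o(1)}`"; Kesten, Comm. Math. Phys. 109 (1987), Thm. 2 / Cor. 2
(scaling relations)). For site percolation on `𝕋`, `θ(p) = (p - 1/2)^{5/36 + o(1)}` as
`p ↓ 1/2`, i.e. `log θ(p) / log (p - 1/2) → 5/36` along `𝓝[>] (1/2)` (`HasRightPowerLaw`;
`triThetaReal` is `θ` as a function of a real parameter). [cite: SmirnovWernerMRL2001, Thm. 1 (i) (arXiv:math/0109120 numbering)] [cite: KestenScalingCMP1987, Thm. 2 and Cor. 2] -/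
def triTheta_exponent : Prop :=
  HasRightPowerLaw triThetaReal (1 / 2) (5 / 36)

/-- **crit-perc.S16** (exponent `ν = 4/3`; Smirnov–Werner, Math. Res. Lett. 8 (2001) =
arXiv:math/0109120, Thm. 1 "Behaviour near the critical point", (iii)–(iv): "When `p → 1/2`,
`ξ(p) = (p - 1/2)^{-4/3 + o(1)}`" for the second-moment length `ξ` of their §2 and likewise for
the length `ξ*` of the exponential decay of finite-cluster connections; Kesten, Comm. Math. Phys.
109 (1987), Thm. 1 and Cor. 1). For site percolation on `𝕋` the correlation length satisfies
`ξ(p) = |p - 1/2|^{-4/3 + o(1)}` as `p → 1/2` from either side, i.e.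
`log ξ(p) / log |p - 1/2| → -4/3` along `𝓝[>] (1/2)` (`HasRightPowerLaw`) and along
`𝓝[<] (1/2)` (`HasLeftPowerLaw`); `triCorrLengthReal` is the finite-cluster correlation length
of `ArmEvents.lean` (exponential decay rate of `P_p(0 ↔ ∂Λ_n, |C| < ∞)`, the radius variant of
`ξ*`) as a function of a real parameter. [cite: SmirnovWernerMRL2001, Thm. 1 (iii)-(iv) (arXiv:math/0109120 numbering)] [cite: KestenScalingCMP1987, Thm. 1 and Cor. 1] -/
def triCorrLength_exponent : Prop :=
  HasRightPowerLaw triCorrLengthReal (1 / 2) (-4 / 3) ∧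
      HasLeftPowerLaw triCorrLengthReal (1 / 2) (-4 / 3)

/-- **crit-perc.S16** (exponent `γ = 43/18`; Smirnov–Werner, Math. Res. Lett. 8 (2001) =
arXiv:math/0109120, Thm. 1 "Behaviour near the critical point", (ii): "When `p → 1/2`,
`χ(p) = (p - 1/2)^{-43/18 + o(1)}`" with `χ(p) = E_p[N 1_{N < ∞}]` the mean size of finite
clusters (their §2); Kesten, Comm. Math. Phys. 109 (1987), Thm. 1 and Cor. 1
(`γ = γ' = 43/18`)). For site
percolation on `𝕋` the finite-cluster mean cluster size
`χ^f(p) = E_p[|C(0)|; |C(0)| < ∞]` satisfies `χ^f(p) = |p - 1/2|^{-43/18 + o(1)}` as `p → 1/2`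
from either side, i.e. `log χ^f(p) / log |p - 1/2| → -43/18` along `𝓝[>] (1/2)`
(`HasRightPowerLaw`) and along `𝓝[<] (1/2)` (`HasLeftPowerLaw`). Here
`triMeanClusterSizeReal p = χ^f(p) : ℝ≥0∞`; for `p < 1/2` it equals the mean cluster size
`χ(p) = E_p|C(0)|` (all clusters are finite a.s.), and it is finite for every `p ≠ 1/2`
(Kesten 1987, (1.16)), so `ENNReal.toReal` (junk `∞ ↦ 0`) is harmless on a punctured
neighbourhood of `1/2`. Proof status: see the module docstring (last section) — reduced in the
tree (`triMeanClusterSize_exponent_of_facts3`, `MeanClusterSizeExponentFromFourFacts.lean`;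
`triMeanClusterSize_exponent_of_separation`, `MeanClusterSizeExponentFromSeparation.lean`) to
the two arm exponents `oneArm_exponent`, `fourArm_exponent` of this file and near-critical
four-arm separation (equivalently the named facts `Werner2009_fourArm_quasiMult` and
`Werner2009_pivotal_lowerBound`), none of which is in the tree yet; everything else of
Kesten's / Nolin's proof is proved there. [cite: KestenScalingCMP1987, (1.16)] [cite: SmirnovWernerMRL2001, Thm. 1 (ii) (γ = 43/18; arXiv:math/0109120 numbering)] -/
def triMeanClusterSize_exponent : Prop :=
  HasRightPowerLaw (fun p => (triMeanClusterSizeReal p).toReal) (1 / 2) (-43 / 18) ∧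
      HasLeftPowerLaw (fun p => (triMeanClusterSizeReal p).toReal) (1 / 2) (-43 / 18)

end Literature.Probability.Percolation
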